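import Summits.QuantumFields.YangMills.Theorems.AlphaInputsT3ACv3StartKnit
import Summits.QuantumFields.YangMills.Theorems.AlphaInputsT3ACv3AxialLine
import HarnessLib

/-!
# `AlphaInputsT3ACv3StartLine` — START v3.1 for the (FL) `hLift` binder, rows (S5)-4∕(S6): **THE CENTRE LINE OF A COARSE BOND IS QUIET** — for `c : PBond P k` the `L^k` finest bonds
# `⟨shift^[t] ĉ₋, c.dir⟩` (`ĉ₋ = toFine k c.src`, the cell CENTRE, `val_toFine`) lie in NO vertex cube of the canonical system (transverse chart offset `≡ −h (mod L^k)`, so `|·| ≥ h > R`)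
# and carry NO active tube bond (an active `c.dir`-bond of a tube `Q` has its other transverse chart coordinate in the β-window `|·| ≤ 2r < h`); hence ★★ `startSys = iterSec k V` on the
# centre line and ★★★ `axialT (startSys …) ĉ₋ ĉ₊ = axialT (iterSec k V) ĉ₋ ĉ₊` — the binder `hline` of ★w5 g2's `StartDefectBox.norm_startDefect_sub_one_le_of_box` — lane `pub-balaban3d`
# ∕ cell `ym3-torus`, seat `ym-ust-19936-w1` (g2, LEAD)

WHY (bus ★w5 g2 03:23:58Z∕03:27:57Z: «`hline` ⇐ `startU_apply_of_quiet` on the Lᵏ centre-line bonds + `axialT_centre_congr`»; LEAD PROGRESS 6 (iii)).  The (S6) defect bound compares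
the `k`-fold average of the START with that of the section through two box axial gauges anchored at `ĉ₋`; its only non-geometric input besides the plaquette bound is that the two
fields AGREE along the straight centre line from `ĉ₋` to `ĉ₊`.  THIS FILE proves that agreement for the canonical system of `…v3StartSystem` (ball model fields arbitrary).
WHAT IS HERE: §1 `iterate_shift_apply_ne`, `h_le_abs_of_eq` (`h ≤ |M·L^k − h|`), `exists_int_of_boxSite_eq` (chart residues); §2 ★`centre_not_ballBond`; §3 ★`centre_not_tubeActive`;
§4 ★★`startSys_centre_eq_iterSec`, ★★★`axialT_startSys_centre`.
HONEST FRAMING.  Lattice bookkeeping; no estimate; (FL)∕`hLift` NOT proved; count-neutral helper toward R3 2′ (items 19936∕19935); registry untouched; nothing about d = 4, the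
continuum, or a mass gap; YM₃ on T³ is rung R3, not Clay.

References: T. Bałaban, Commun. Math. Phys. 102 (1985) 277–309 [Balaban1985Variational] ((11)–(14) pp.279–280); Commun. Math. Phys. 98 (1985) 17–51 [Balaban1985Averaging]
((8)–(9) p.18–19, pp.24–25).
-/

set_option autoImplicit false

noncomputable section

open scoped Matrix.Norms.L2Operator

namespace Summit.QuantumFields.YangMills.Theorems.TubeStart

open Literature.MathematicalPhysics.QuantumFieldTheory.Balaban1983to89
open Literature.MathematicalPhysics.QuantumFieldTheory.Balaban1983to89.T4AdjointCovarianceUnitary (lieSU expSU)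
open Literature.MathematicalPhysics.QuantumFieldTheory.Balaban1983to89.BlockAveragingSectionAction (iterSec)
open Literature.MathematicalPhysics.QuantumFieldTheory.Balaban1983to89.B10Eq38TorusDomains (toFine plaqsIn)
open Literature.MathematicalPhysics.QuantumFieldTheory.Balaban1983to89.B10Eq27TorusAxialLog (axialT)
open Summit.QuantumFields.Balaban3D.Carriers
open Summit.QuantumFields.YangMills.Theorems.ModelBox
open Summit.QuantumFields.YangMills.Theorems.TubeProfile (betaQB betaQB_window betaQB_touches)
open Summit.QuantumFields.YangMills.Theorems.LinearLiftSpread (val_toFine)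
open Summit.QuantumFields.YangMills.Theorems.Prop7FlatHolonomy (sitesPerDir_zero_eq_mul_pow)
open Summit.QuantumFields.YangMills.Theorems.StartDefectBox (axialT_centre_congr)

/-! ## §1 Arithmetic of the centre line -/

section Arith

variable {P : Params}

/-- Shifting in direction `μ` leaves the other coordinates alone, any number of times. [folklore] -/
theorem iterate_shift_apply_ne {j : ℕ} (x : Site P j) {μ i : Fin P.d} (h : i ≠ μ) : ∀ t : ℕ, ((fun z : Site P j => z.shift μ)^[t] x) i = x i
  | 0 => rfl
  | t + 1 => by
    rw [Function.iterate_succ_apply']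
    simp only [Site.shift, Function.update_apply, if_neg h]
    exact iterate_shift_apply_ne x h t

/-- `h ≤ |M·(2h+1) − h|` for every integer `M`. [folklore] -/
theorem h_le_abs_of_eq {h : ℕ} (M : ℤ) : (h : ℤ) ≤ |M * (2 * (h : ℤ) + 1) - h| := by
  rcases le_or_gt 1 M with hM | hM
  · rw [abs_of_nonneg (by nlinarith)]; nlinarith
  · rw [abs_of_nonpos (by nlinarith)]; nlinarith

/-- **CHART RESIDUES**: if `boxSite c₀ u = x` then `u_i = x_i.val − a + M·N₀` for every presentation `c₀ i = (a : ℕ)`. [folklore] -/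
theorem exists_int_of_boxSite_eq {c₀ x : Site P 0} {u : Fin P.d → ℤ} (h : boxSite c₀ u = x) (i : Fin P.d) {a : ℕ} (ha : c₀ i = ((a : ℕ) : ZMod (P.sitesPerDir 0))) :
    ∃ M : ℤ, u i = ((x i).val : ℤ) - a + M * (P.sitesPerDir 0 : ℕ) := by
  have hc := congrFun h i
  simp only [boxSite] at hc
  rw [ha] at hc
  have hx : (x i : ZMod (P.sitesPerDir 0)) = (((x i).val : ℕ) : ZMod (P.sitesPerDir 0)) := (ZMod.natCast_zmod_val (x i)).symm
  rw [hx] at hc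
  have hc' : ((((a : ℤ) + u i : ℤ)) : ZMod (P.sitesPerDir 0)) = ((((x i).val : ℤ)) : ZMod (P.sitesPerDir 0)) := by push_cast at hc ⊢; exact hc
  rw [ZMod.intCast_eq_intCast_iff_dvd_sub] at hc'
  obtain ⟨M, hM⟩ := hc'
  exact ⟨-M, by linarith⟩

/-- **THE CENTRE LINE'S TRANSVERSE OFFSET**: if `boxSite c₀ u = shift^[t] (toFine k y₀)` and `c₀ i = y_i·L^k + 2⌊L^k∕2⌋` for a direction `i ≠` the shift direction, then `⌊L^k∕2⌋ ≤ |u_i|`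
(`N₀ = N_k·L^k`, `L^k = 2⌊L^k∕2⌋ + 1`). [folklore] -/
theorem half_le_abs_of_centre {k : ℕ} (hk : k ≤ P.m + P.K) {c₀ : Site P 0} {u : Fin P.d → ℤ} {y₀ : Site P k} {μ i : Fin P.d} (hi : i ≠ μ) {t : ℕ}
    (h : boxSite c₀ u = (fun z : Site P 0 => z.shift μ)^[t] (toFine k y₀)) {yi : ℕ} (hc : c₀ i = (((yi * P.L ^ k + 2 * (P.L ^ k / 2)) : ℕ) : ZMod (P.sitesPerDir 0))) :
    ((P.L ^ k / 2 : ℕ) : ℤ) ≤ |u i| := by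
  obtain ⟨M, hM⟩ := exists_int_of_boxSite_eq h i hc
  rw [iterate_shift_apply_ne (toFine k y₀) hi t, val_toFine k hk y₀ i] at hM
  have hN : P.sitesPerDir 0 = P.sitesPerDir k * P.L ^ k := sitesPerDir_zero_eq_mul_pow hk
  have hL : P.L ^ k = 2 * (P.L ^ k / 2) + 1 := pow_eq_two_mul_half_add_one k
  set hh : ℕ := P.L ^ k / 2 with hh_def
  -- `u i = M'·L^k − h` with `M' = y₀_i − yi + M·N_k`
  have hL' : ((P.L : ℤ)) ^ k = 2 * (hh : ℤ) + 1 := by exact_mod_cast hL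
  have key : u i = (((y₀ i).val : ℤ) - yi + M * (P.sitesPerDir k : ℕ)) * (2 * (hh : ℤ) + 1) - hh := by
    rw [hM, hN]; push_cast; rw [hL']; ring
  rw [key]
  exact h_le_abs_of_eq _

end Arith

/-! ## §2 The centre line misses the vertex cubes -/

section Balls

variable {P : Params} {k : ℕ} (hk : k ≤ P.m + P.K) (Ω : Set (Site P 0)) (c : PBond P k)
include hk

/-- **★ NO CENTRE-LINE BOND IS A BALL BOND** of any vertex cube of half-side `R < ⌊L^k∕2⌋` (a direction other than `c.dir` exists: `2 ≤ d`). [folklore] -/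
theorem centre_not_ballBond (hd : 2 ≤ P.d) {R : ℕ} (hR : R < P.L ^ k / 2) (y : Site P k) (t : ℕ) :
    ¬ BallBond (vertexSite k y) R ⟨(fun z : Site P 0 => z.shift c.dir)^[t] (toFine k c.src), c.dir⟩ := by
  rintro ⟨u, hu, -, hsrc⟩
  -- a direction `i ≠ c.dir`
  obtain ⟨i, hi⟩ : ∃ i : Fin P.d, i ≠ c.dir := by
    by_cases h0 : (c.dir : ℕ) = 0
    · exact ⟨⟨1, by omega⟩, fun h => by have := congrArg Fin.val h; simp at this; omega⟩
    · exact ⟨⟨0, by omega⟩, fun h => by have := congrArg Fin.val h; simp at this; omega⟩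
  have hL : P.L ^ k = 2 * (P.L ^ k / 2) + 1 := pow_eq_two_mul_half_add_one k
  have hc : vertexSite k y i = ((((y i).val * P.L ^ k + 2 * (P.L ^ k / 2)) : ℕ) : ZMod (P.sitesPerDir 0)) := by
    rw [vertexSite_apply]; congr 2; omega
  have h1 := half_le_abs_of_centre hk hi hsrc hc
  have h2 := hu i
  have : (R : ℤ) < (P.L ^ k / 2 : ℕ) := by exact_mod_cast hR
  linarith

/-- Hence no centre-line bond is a ball bond of the canonical system (`RbT < ⌊L^k∕2⌋`). [folklore] -/
theorem centre_not_isBallΩ (hd : 2 ≤ P.d) (hR : RbT P k < P.L ^ k / 2) (t : ℕ) :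
    ¬ ∃ v, IsBallΩ k Ω v ∧ BallBond v (RbT P k) ⟨(fun z : Site P 0 => z.shift c.dir)^[t] (toFine k c.src), c.dir⟩ := by
  rintro ⟨v, ⟨y, -, rfl⟩, hb⟩
  exact centre_not_ballBond hk c hd hR y t hb

end Balls

/-! ## §3 The centre line carries no active tube bond -/

section Tubes

variable {P : Params} {n : Type*} [Fintype n] [DecidableEq n] [Nonempty n] {k : ℕ} (hk : k ≤ P.m + P.K) (Ω : Set (Site P 0))
  (V : GaugeField P k (Matrix.specialUnitaryGroup n ℂ)) (c : PBond P k)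
include hk

/-- **★ NO CENTRE-LINE BOND IS AN ACTIVE TUBE BOND** (`2r < ⌊L^k∕2⌋`; chart rows `Rt + 2 ≤ L^k`, `2·max(Rt, ⌊L^k∕2⌋) + 1 ≤ N₀`; the tube's flux in the log window). [cite: Balaban1985Variational, (11) p.279] -/
theorem centre_not_tubeActive (hRt : RtT P k + 2 ≤ P.L ^ k) (hN : 2 * max (RtT P k) (P.L ^ k / 2) + 1 ≤ P.sitesPerDir 0) (hr : 2 * rT P k < P.L ^ k / 2)
    (hF : ∀ Q, IsTubeΩ k Ω Q → expSU (FpOf k V Q) = V ⟨Q.src, Q.ν⟩ * V ⟨Q.src.shift Q.ν, Q.μ⟩ * (V ⟨Q.src.shift Q.μ, Q.ν⟩)⁻¹ * (V ⟨Q.src, Q.μ⟩)⁻¹) (t : ℕ) :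
    ¬ ∃ Q, TubeActive V (RtT P k) (FpOf k V) (tfOf k Ω) (IsTubeΩ k Ω) Q ⟨(fun z : Site P 0 => z.shift c.dir)^[t] (toFine k c.src), c.dir⟩ := by
  rintro ⟨Q, hact⟩
  have hQ : IsTubeΩ k Ω Q := hact.1
  obtain ⟨u, hu, -, hsrc, hne⟩ := exists_chart_of_tubeActive V (RtT P k) (FpOf k V) (tfOf k Ω) (IsTubeΩ k Ω) hk hRt hN (hF Q hQ) hact
  -- the form differs from the string indicator only inside the β-window, on transverse bonds
  have hβ : betaQB (rT P k) (quadOf Ω Q).1 (quadOf Ω Q).2 Q.μ Q.ν u c.dir ≠ 0 := by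
    intro h0
    apply hne
    show (stringInd Q.μ Q.ν + betaQB (rT P k) (quadOf Ω Q).1 (quadOf Ω Q).2 Q.μ Q.ν) u c.dir = stringInd Q.μ Q.ν u c.dir
    rw [Pi.add_apply, Pi.add_apply, h0, add_zero]
  have hμν : Q.μ ≠ Q.ν := ne_of_lt Q.hμν
  obtain ⟨hdir, -⟩ := betaQB_touches (rT P k) (quadOf Ω Q).1 (quadOf Ω Q).2 Q.μ Q.ν hμν hβ
  obtain ⟨hwμ, hwν⟩ := betaQB_window (rT P k) (quadOf Ω Q).1 (quadOf Ω Q).2 Q.μ Q.ν hβ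
  -- the OTHER transverse direction of `Q`
  have hr' : (2 * rT P k : ℤ) < (P.L ^ k / 2 : ℕ) := by exact_mod_cast hr
  rcases hdir with hdμ | hdν
  · -- `c.dir = Q.μ`: use `i := Q.ν`
    have hi : Q.ν ≠ c.dir := by rw [hdμ]; exact hμν.symm
    have hc : cornerSite k Q.src Q.μ Q.ν Q.ν = ((((Q.src Q.ν).val * P.L ^ k + 2 * (P.L ^ k / 2)) : ℕ) : ZMod (P.sitesPerDir 0)) :=
      cornerSite_apply_of_mem k Q.src (Or.inr rfl)
    have h1 := half_le_abs_of_centre hk hi hsrc hc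
    linarith
  · -- `c.dir = Q.ν`: use `i := Q.μ`
    have hi : Q.μ ≠ c.dir := by rw [hdν]; exact hμν
    have hc : cornerSite k Q.src Q.μ Q.ν Q.μ = ((((Q.src Q.μ).val * P.L ^ k + 2 * (P.L ^ k / 2)) : ℕ) : ZMod (P.sitesPerDir 0)) :=
      cornerSite_apply_of_mem k Q.src (Or.inl rfl)
    have h1 := half_le_abs_of_centre hk hi hsrc hc
    linarith

end Tubes

/-! ## §4 The start field on the centre line -/

section Line

variable {P : Params} {n : Type*} [Fintype n] [DecidableEq n] [Nonempty n] {k : ℕ} (hk : k ≤ P.m + P.K) (Ω : Set (Site P 0))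
  (V : GaugeField P k (Matrix.specialUnitaryGroup n ℂ)) (Mball : Site P 0 → (Fin P.d → ℤ) → Fin P.d → Matrix.specialUnitaryGroup n ℂ) (c : PBond P k)
  (hd : 2 ≤ P.d) (hR : RbT P k < P.L ^ k / 2) (hRt : RtT P k + 2 ≤ P.L ^ k) (hN : 2 * max (RtT P k) (P.L ^ k / 2) + 1 ≤ P.sitesPerDir 0)
  (hF : ∀ Q, IsTubeΩ k Ω Q → expSU (FpOf k V Q) = V ⟨Q.src, Q.ν⟩ * V ⟨Q.src.shift Q.ν, Q.μ⟩ * (V ⟨Q.src.shift Q.μ, Q.ν⟩)⁻¹ * (V ⟨Q.src, Q.μ⟩)⁻¹)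
include hk hd hR hRt hN hF

/-- **★★ ON THE CENTRE LINE THE CANONICAL START FIELD IS THE SECTION.** [cite: Balaban1985Variational, (11) p.279] -/
theorem startSys_centre_eq_iterSec (t : ℕ) :
    startSys k Ω V Mball ⟨(fun z : Site P 0 => z.shift c.dir)^[t] (toFine k c.src), c.dir⟩ = iterSec k V ⟨(fun z : Site P 0 => z.shift c.dir)^[t] (toFine k c.src), c.dir⟩ := by
  have hr : 2 * rT P k < P.L ^ k / 2 := by unfold RbT at hR; omega
  exact startSys_apply_of_quiet k Ω V Mball (centre_not_isBallΩ hk Ω c hd hR t) (centre_not_tubeActive hk Ω V c hRt hN hr hF t)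

/-- **★★★ THE `hline` BINDER OF THE (S6) BOX THEOREM**: the axial transports of the START and of the section from `ĉ₋` to `ĉ₊` coincide (`2L^k ≤ N₀`).
[cite: Balaban1985Averaging, (8)–(9) p.18, pp.24–25] -/
theorem axialT_startSys_centre (hN2 : ((P.L ^ k : ℕ) : ℤ) * 2 ≤ (P.sitesPerDir 0 : ℤ)) :
    axialT (startSys k Ω V Mball) (toFine k c.src) (toFine k c.tgt) = axialT (iterSec k V) (toFine k c.src) (toFine k c.tgt) :=
  axialT_centre_congr hk hN2 _ _ c fun t _ => startSys_centre_eq_iterSec hk Ω V Mball c hd hR hRt hN hF t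

end Line

end Summit.QuantumFields.YangMills.Theorems.TubeStart

end
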